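import Literature.MathematicalPhysics.QuantumManyBody.PeriodicBoseGasSectorOps
import Mathlib.MeasureTheory.Group.LIntegral
import HarnessLib

/-!
# Fournais 2020, (2.43) from (2.25) and Lemma 2.4

Topic `Literature/MathematicalPhysics/QuantumManyBody` (provefact
`Literature.MathematicalPhysics.QuantumManyBody.BoseGas.Fournais2020_condensation`). We prove
`Fournais2020_eq243_of_eq225_lemma24 : Fournais2020_eq225 → Fournais2020_lemma24 → Fournais2020_eq243`:
the `n`-particle bound [Fournais2020, (2.43)–(2.46)] (`Fournais2020_eq243`,
`PeriodicBoseGasSector.lean`) is the sum of (2.25) (Lemma 2.3) and (2.26) (Lemma 2.4)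
(`PeriodicBoseGasSectorOps.lean`): "Using Lemma 2.3 (in the form of (2.25)) and Lemma 2.4 …
combining the terms, remembering that the 'gap' of the kinetic energy was saved" — the pairing
term `A₂` cancels, the main terms combine to `E_Main - (n/(2ℓ³))∫gω` by (2.44), and
`∫gω ≤ ∫g = 8πa` puts the last term into `E_error`; with the constants `C₁` of (2.25) and `C₂`
of (2.26), (2.43) holds with `C = C₁ + C₂ + 4π`.

The vendored (2.25), (2.26) are real inequalities on states whose forms are finite; (2.43) is
additive in `ℝ≥0∞`. If the kinetic, repulsion or norm form of `Φ` is infinite, (2.43) is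
trivial; otherwise `⟨n₊⟩ ≤ (ℓ²/b)∑⟨T^{(i)}⟩` and, for `R/ℓ` small (`χ*χ ≥ ½` on `B(0,R/ℓ)`, so
`W₁ ≤ 2g` and `∫w₁(x,y)dy ≤ 2‖χ‖²_∞ 8πa`), the attraction is finite too, and the real
inequalities transfer.

## References

* [Fournais2020] S. Fournais, *Length scales for BEC in the dilute Bose gas*, arXiv:2011.00309,
  EMS Ser. Congr. Rep. 18 (2021): (2.25), Lemma 2.4 (2.26), (2.43)–(2.46).
-/

noncomputable section

open MeasureTheory Filter
open scoped ENNReal NNReal Topology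

namespace Literature.MathematicalPhysics.QuantumManyBody.BoseGas

variable {N : ℕ} {χ : Space → ℝ} {v : ℝ → ℝ≥0∞} {ω : Space → ℝ} {ℓ : ℝ} {u : Space}

/-! ### Finiteness of the attraction for `R/ℓ` small -/

section Finiteness

/-- `χ*χ ≥ ½` near the origin (`χ*χ` is continuous with `(χ*χ)(0) = ∫χ² = 1`): the quantitative
well-definedness of `W = v/(χ*χ)(x/ℓ)` for `R/ℓ` small. [cite: Fournais2020, (2.4)] -/
theorem exists_selfConv_ge_half (hχ : IsLocalizationFunction χ) :
    ∃ D : ℝ, 0 < D ∧ ∀ y : Space, ‖y‖ ≤ D → 2⁻¹ ≤ selfConv χ y := by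
  have hev : ∀ᶠ y in 𝓝 (0 : Space), 2⁻¹ < selfConv χ y := by
    have ht : Tendsto (selfConv χ) (𝓝 0) (𝓝 1) := by
      have h := hχ.continuous_selfConv.continuousAt (x := (0 : Space))
      rwa [ContinuousAt, hχ.selfConv_zero] at h
    exact ht.eventually_const_lt (by norm_num)
  obtain ⟨ε, hε, hball⟩ := Metric.eventually_nhds_iff.mp hev
  refine ⟨ε / 2, by positivity, fun y hy => (hball ?_).le⟩
  rw [dist_zero_right]
  linarith

/-- **`W₁ ≤ 2g` for `R/ℓ` small** ("`0 ≤ W₁ ≤ (1 + C(R/ℓ)²)g`", proof of Lemma 2.4): if `v`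
vanishes beyond `R`, `R/ℓ ≤ D` and `χ*χ ≥ ½` on `B̄(0,D)`. [cite: Fournais2020, (2.8), (2.42)] -/
theorem bigW₁_le_two_mul {R D : ℝ} (hR : ∀ r, R < r → v r = 0) (hℓ : 0 < ℓ)
    (hD : ∀ y : Space, ‖y‖ ≤ D → 2⁻¹ ≤ selfConv χ y) (hRℓ : R / ℓ ≤ D) (z : Space) :
    bigW₁ v ω χ ℓ z ≤ 2 * (v ‖z‖ * ENNReal.ofReal (1 - ω z)) := by
  unfold bigW₁
  by_cases hz : ‖z‖ ≤ R
  · have hsc : 2⁻¹ ≤ selfConv χ (ℓ⁻¹ • z) := by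
      refine hD _ ?_
      rw [norm_smul, norm_inv, Real.norm_eq_abs, abs_of_pos hℓ]
      calc ℓ⁻¹ * ‖z‖ ≤ ℓ⁻¹ * R := by gcongr
        _ = R / ℓ := by rw [div_eq_inv_mul]
        _ ≤ D := hRℓ
    have hden : (2⁻¹ : ℝ≥0∞) ≤ ENNReal.ofReal (selfConv χ (ℓ⁻¹ • z)) := by
      have h2 : (2⁻¹ : ℝ≥0∞) = ENNReal.ofReal 2⁻¹ := by
        rw [ENNReal.ofReal_inv_of_pos two_pos, ENNReal.ofReal_ofNat]
      rw [h2]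
      exact ENNReal.ofReal_le_ofReal hsc
    refine ENNReal.div_le_of_le_mul ?_
    calc v ‖z‖ * ENNReal.ofReal (1 - ω z)
        = 2 * (v ‖z‖ * ENNReal.ofReal (1 - ω z)) * 2⁻¹ := by
          rw [mul_comm (2 : ℝ≥0∞), mul_assoc, ENNReal.mul_inv_cancel two_ne_zero ENNReal.ofNat_ne_top,
            mul_one]
      _ ≤ 2 * (v ‖z‖ * ENNReal.ofReal (1 - ω z)) * ENNReal.ofReal (selfConv χ (ℓ⁻¹ • z)) := by
          gcongr
  · rw [hR _ (not_le.mp hz), zero_mul, ENNReal.zero_div]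
    exact zero_le

/-- **The one-body attraction is bounded**: `∫ w₁(x,y) dy ≤ 2‖χ‖²_∞ ∫g = 2‖χ‖²_∞ 8πa` for
`R/ℓ` small. [cite: Fournais2020, (2.8), (2.10)] -/
theorem lintegral_pairLoc₁_le {R D Cχ : ℝ} (hω : IsScatteringSolution v ω)
    (hR : ∀ r, R < r → v r = 0) (hℓ : 0 < ℓ) (hCχ : ∀ x, ‖χ x‖ ≤ Cχ)
    (hD : ∀ y : Space, ‖y‖ ≤ D → 2⁻¹ ≤ selfConv χ y) (hRℓ : R / ℓ ≤ D) (x : Space) :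
    ∫⁻ y, pairLoc₁ v ω χ ℓ u x y ≤
      ENNReal.ofReal Cχ * ENNReal.ofReal Cχ * 2 * (ENNReal.ofReal (8 * Real.pi) * scatteringLength v) := by
  have hχb : ∀ z, locFun χ ℓ u z ≤ Cχ := fun z => (Real.le_norm_self _).trans (hCχ _)
  calc ∫⁻ y, pairLoc₁ v ω χ ℓ u x y
      ≤ ∫⁻ y, ENNReal.ofReal Cχ * (2 * (v ‖x - y‖ * ENNReal.ofReal (1 - ω (x - y)))) *
          ENNReal.ofReal Cχ := by
        refine lintegral_mono fun y => ?_
        unfold pairLoc₁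
        gcongr
        · exact hχb x
        · exact bigW₁_le_two_mul hR hℓ hD hRℓ _
        · exact hχb y
    _ = ENNReal.ofReal Cχ * ENNReal.ofReal Cχ * 2 *
          ∫⁻ y, v ‖x - y‖ * ENNReal.ofReal (1 - ω (x - y)) := by
        rw [← lintegral_const_mul' _ _ (by finiteness)]
        refine lintegral_congr fun y => ?_
        ring
    _ = ENNReal.ofReal Cχ * ENNReal.ofReal Cχ * 2 * (ENNReal.ofReal (8 * Real.pi) * scatteringLength v) := by
        rw [lintegral_sub_left_eq_self (μ := (volume : Measure Space))
          (fun z => v ‖z‖ * ENNReal.ofReal (1 - ω z)) x, hω.lintegral_g]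

/-- **The attraction form is finite** on states of finite norm, for `R/ℓ` small:
`ρ_μ∑ᵢ∫∫w₁(xᵢ,y)dy|Φ|² ≤ ρ_μ n (2‖χ‖²_∞ 8πa) ‖Φ‖²`. [cite: Fournais2020, (2.6), (2.10)] -/
theorem lintegral_attrBoxN_le {R D Cχ : ℝ} (hω : IsScatteringSolution v ω)
    (hsL : scatteringLength v ≠ ⊤) (hR : ∀ r, R < r → v r = 0) (hℓ : 0 < ℓ) (hCχ : ∀ x, ‖χ x‖ ≤ Cχ)
    (hD : ∀ y : Space, ‖y‖ ≤ D → 2⁻¹ ≤ selfConv χ y) (hRℓ : R / ℓ ≤ D) (ρμ : ℝ) (u : Space)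
    (Φ : Config N → ℂ) :
    (∫⁻ X in boxConfig N ℓ u, attrBoxN v ω χ ℓ ρμ u X * (‖Φ X‖₊ : ℝ≥0∞) ^ 2) ≤
      ENNReal.ofReal ρμ * (N * (ENNReal.ofReal Cχ * ENNReal.ofReal Cχ * 2 *
          (ENNReal.ofReal (8 * Real.pi) * scatteringLength v))) *
        ∫⁻ X in boxConfig N ℓ u, (‖Φ X‖₊ : ℝ≥0∞) ^ 2 := by
  rw [← lintegral_const_mul' _ _ (by
    refine ENNReal.mul_ne_top ENNReal.ofReal_ne_top (ENNReal.mul_ne_top (by finiteness) ?_)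
    exact ENNReal.mul_ne_top (by finiteness)
      (ENNReal.mul_ne_top ENNReal.ofReal_ne_top hsL))]
  refine lintegral_mono fun X => mul_le_mul_left ?_ _
  unfold attrBoxN
  refine mul_le_mul_right ?_ _
  calc ∑ i : Fin N, ∫⁻ y, pairLoc₁ v ω χ ℓ u (X i) y
      ≤ ∑ _i : Fin N, ENNReal.ofReal Cχ * ENNReal.ofReal Cχ * 2 *
          (ENNReal.ofReal (8 * Real.pi) * scatteringLength v) :=
        Finset.sum_le_sum fun i _ => lintegral_pairLoc₁_le hω hR hℓ hCχ hD hRℓ _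
    _ = _ := by rw [Finset.sum_const, Finset.card_univ, Fintype.card_fin, nsmul_eq_mul]

end Finiteness

/-! ### (2.43) = (2.25) + (2.26) -/

section Assembly

/-- **The algebra of (2.43)–(2.46)**: adding (2.25) and (2.26), the pairing terms `A₂` cancel,
`[n²/(2ℓ³)(8πa+∫gω) - (ρ_μn/ℓ³ + ¼(ρ_μ-n/ℓ³)²)8πaℓ³] - n(n+1)/(2ℓ³)∫gω = E_Main - (n/(2ℓ³))∫gω`
with `E_Main = -4πaρ_μ²ℓ³ + 2π(a/ℓ³)(ρ_μℓ³-n)²` (2.44), `(n/(2ℓ³))∫gω ≤ 4πan/ℓ³` (`∫gω ≤ 8πa`),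
and the constants `C₁, C₂` are dominated by `C = C₁ + C₂ + 4π` in (2.45)–(2.46). Real
arithmetic on the (finite) expectations `ar, kr, rr` (attraction, kinetic, repulsion), `Nr = ⟨n₊⟩`,
`nr = ‖Φ‖²`. [cite: Fournais2020, (2.43)–(2.46)] -/
theorem eq243_real {ar kr rr Nr nr A2 Ig a ρμ ℓ b C₁ C₂ R : ℝ} {n : ℕ}
    (hNr : 0 ≤ Nr) (hnr : 0 ≤ nr) (ha : 0 ≤ a) (hρμ : 0 ≤ ρμ) (hℓ : 0 < ℓ) (hC₁ : 0 ≤ C₁) (hC₂ : 0 ≤ C₂)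
    (hIg : Ig ≤ 8 * Real.pi * a)
    (h25 : A2 + ((n : ℝ) ^ 2 / (2 * ℓ ^ 3) * (8 * Real.pi * a + Ig) -
        (ρμ * n / ℓ ^ 3 + 4⁻¹ * (ρμ - n / ℓ ^ 3) ^ 2) * (8 * Real.pi * a * ℓ ^ 3)) * nr -
        C₁ * a * (ρμ + n / ℓ ^ 3) * (Nr + nr) ≤ rr - ar)
    (h26 : -((n : ℝ) * (n + 1) / (2 * ℓ ^ 3) * Ig * nr) - C₂ * a * ((n + 1) / ℓ ^ 3) * Nr -
        C₂ * n * a / ℓ ^ 3 * (1 + a ^ 2 * (n + 1) ^ 2 / ℓ ^ 2 + (n + 1) * R ^ 2 / ℓ ^ 2) * nr ≤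
        kr - b / ℓ ^ 2 * Nr + A2) :
    ar + 2 * Real.pi * (a / ℓ ^ 3) * (ρμ * ℓ ^ 3 - n) ^ 2 * nr + b / ℓ ^ 2 * Nr ≤
      kr + rr + (C₁ + C₂ + 4 * Real.pi) * a * ((n + 1) / ℓ ^ 3 + ρμ) * Nr +
        (4 * Real.pi * a * ρμ ^ 2 * ℓ ^ 3 +
          (C₁ + C₂ + 4 * Real.pi) * n * a / ℓ ^ 3 * (1 + a ^ 2 * (n + 1) ^ 2 / ℓ ^ 2 + (n + 1) * R ^ 2 / ℓ ^ 2) +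
          (C₁ + C₂ + 4 * Real.pi) * a * ρμ) * nr := by
  have hℓ3 : 0 < ℓ ^ 3 := by positivity
  have hn : (0 : ℝ) ≤ n := Nat.cast_nonneg n
  set Bk : ℝ := a ^ 2 * (n + 1) ^ 2 / ℓ ^ 2 + (n + 1) * R ^ 2 / ℓ ^ 2 with hBk
  have hBk0 : 0 ≤ Bk := by positivity
  -- distribute the products over the atoms `Nr`, `nr`
  have e25 : C₁ * a * (ρμ + n / ℓ ^ 3) * (Nr + nr) =
      C₁ * a * (ρμ + n / ℓ ^ 3) * Nr + C₁ * a * (ρμ + n / ℓ ^ 3) * nr := by ring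
  -- the `Nr`-coefficients
  have eN : (C₁ + C₂ + 4 * Real.pi) * a * ((n + 1) / ℓ ^ 3 + ρμ) * Nr -
      (C₁ * a * (ρμ + n / ℓ ^ 3) * Nr + C₂ * a * ((n + 1) / ℓ ^ 3) * Nr) =
      (C₁ * a / ℓ ^ 3 + C₂ * a * ρμ + 4 * Real.pi * a * ((n + 1) / ℓ ^ 3 + ρμ)) * Nr := by ring
  have gN : 0 ≤ (C₁ * a / ℓ ^ 3 + C₂ * a * ρμ + 4 * Real.pi * a * ((n + 1) / ℓ ^ 3 + ρμ)) * Nr :=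
    mul_nonneg (by positivity) hNr
  -- the `nr`-coefficients, with the (2.44) identity and `∫gω ≤ 8πa`
  have en : (4 * Real.pi * a * ρμ ^ 2 * ℓ ^ 3 + (C₁ + C₂ + 4 * Real.pi) * n * a / ℓ ^ 3 * (1 + Bk) +
        (C₁ + C₂ + 4 * Real.pi) * a * ρμ) * nr -
      (2 * Real.pi * (a / ℓ ^ 3) * (ρμ * ℓ ^ 3 - n) ^ 2 * nr -
        ((n : ℝ) ^ 2 / (2 * ℓ ^ 3) * (8 * Real.pi * a + Ig) -
          (ρμ * n / ℓ ^ 3 + 4⁻¹ * (ρμ - n / ℓ ^ 3) ^ 2) * (8 * Real.pi * a * ℓ ^ 3)) * nr +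
        (n : ℝ) * (n + 1) / (2 * ℓ ^ 3) * Ig * nr + C₁ * a * (ρμ + n / ℓ ^ 3) * nr +
        C₂ * n * a / ℓ ^ 3 * (1 + Bk) * nr) =
      (C₁ * n * a / ℓ ^ 3 * Bk + 4 * Real.pi * n * a / ℓ ^ 3 * (1 + Bk) + (C₂ + 4 * Real.pi) * a * ρμ -
        n / (2 * ℓ ^ 3) * Ig) * nr := by
    field_simp
    ring
  have gn : 0 ≤ (C₁ * n * a / ℓ ^ 3 * Bk + 4 * Real.pi * n * a / ℓ ^ 3 * (1 + Bk) +
      (C₂ + 4 * Real.pi) * a * ρμ - n / (2 * ℓ ^ 3) * Ig) * nr := by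
    refine mul_nonneg ?_ hnr
    have h1 : n / (2 * ℓ ^ 3) * Ig ≤ n / (2 * ℓ ^ 3) * (8 * Real.pi * a) :=
      mul_le_mul_of_nonneg_left hIg (by positivity)
    have h2 : n / (2 * ℓ ^ 3) * (8 * Real.pi * a) = 4 * Real.pi * n * a / ℓ ^ 3 := by
      field_simp
      ring
    have h3 : 0 ≤ C₁ * n * a / ℓ ^ 3 * Bk := by positivity
    have h4 : 0 ≤ 4 * Real.pi * n * a / ℓ ^ 3 * Bk := by positivity
    have h5 : 0 ≤ (C₂ + 4 * Real.pi) * a * ρμ := by positivity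
    nlinarith
  linarith [h25, h26, e25, eN, gN, en, gn]

variable (N)

/-- **Fournais 2020, (2.43) from (2.25) and Lemma 2.4.** The vendored form of (2.25) (Lemma 2.3,
[FournaisSolovej2020, Lemma B.2]) and Lemma 2.4 (2.26) imply the `n`-particle bound
(2.43)–(2.46) (`Fournais2020_eq243`), with constant `C = C₁ + C₂ + 4π` and the smallness of
`R/ℓ` also ensuring `χ*χ ≥ ½` on `B̄(0,R/ℓ)` (finiteness of the attraction).
[cite: Fournais2020, (2.43)–(2.46), (2.25), Lemma 2.4] -/
theorem Fournais2020_eq243_of_eq225_lemma24 (h225 : Fournais2020_eq225) (h24 : Fournais2020_lemma24) :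
    Fournais2020_eq243 := by
  intro v hv hint ha ω hω χ hχ b s hb hs R hRpos hR
  obtain ⟨C₁, c₁, hC₁, hc₁, H25⟩ := h225 v hv hint ha ω hω χ hχ R hRpos hR
  obtain ⟨C₂, c₂, hC₂, hc₂, H26⟩ := h24 v hv hint ha ω hω χ hχ s hs R hRpos hR
  obtain ⟨D, hD, hDhalf⟩ := exists_selfConv_ge_half hχ
  obtain ⟨Cχ, hCχ⟩ := hχ.hasCompactSupport.exists_bound_of_continuous hχ.contDiff.continuous
  have hsL : scatteringLength v ≠ ⊤ := by
    refine scatteringLength_ne_top ?_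
    rw [lintegral_const_mul' _ _ (ENNReal.inv_ne_top.2 two_ne_zero)]
    exact ENNReal.mul_ne_top (ENNReal.inv_ne_top.2 two_ne_zero) hint
  have ha0 : 0 < (scatteringLength v).toReal := ENNReal.toReal_pos ha.ne' hsL
  refine ⟨C₁ + C₂ + 4 * Real.pi, min (min c₁ c₂) D, by positivity, by positivity, ?_⟩
  intro ℓ ρμ hℓ hρμ hRℓ
  dsimp only
  intro n u Φ hΦm hΦs
  set a : ℝ := (scatteringLength v).toReal with hadef
  have hRℓ1 : R ≤ c₁ * ℓ := hRℓ.trans (by gcongr; exact (min_le_left _ _).trans (min_le_left _ _))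
  have hRℓ2 : R ≤ c₂ * ℓ := hRℓ.trans (by gcongr; exact (min_le_left _ _).trans (min_le_right _ _))
  have hRD : R / ℓ ≤ D := by
    rw [div_le_iff₀ hℓ]
    exact hRℓ.trans (by gcongr; exact min_le_right _ _)
  -- the forms
  set nrm := ∫⁻ X in boxConfig n ℓ u, (‖Φ X‖₊ : ℝ≥0∞) ^ 2 with hnrm
  set rep := ∫⁻ X in boxConfig n ℓ u, repBoxN v χ ℓ u X * (‖Φ X‖₊ : ℝ≥0∞) ^ 2 with hrep
  set attr := ∫⁻ X in boxConfig n ℓ u, attrBoxN v ω χ ℓ ρμ u X * (‖Φ X‖₊ : ℝ≥0∞) ^ 2 with hattr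
  set kin := kinBoxN χ ℓ s b u Φ with hkin
  set Np := nPlusBoxN ℓ u Φ with hNp
  -- infinite forms: (2.43) is trivial
  by_cases hkt : kin = ⊤
  · rw [hkt]; simp only [top_add]; exact le_top
  by_cases hrt : rep = ⊤
  · rw [hrt]; simp only [add_top, top_add]; exact le_top
  have hcoef : 0 < 4 * Real.pi * a * ρμ ^ 2 * ℓ ^ 3 +
      (C₁ + C₂ + 4 * Real.pi) * n * a / ℓ ^ 3 * (1 + a ^ 2 * (n + 1) ^ 2 / ℓ ^ 2 + (n + 1) * R ^ 2 / ℓ ^ 2) +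
      (C₁ + C₂ + 4 * Real.pi) * a * ρμ := by positivity
  by_cases hnt : nrm = ⊤
  · have h0 : ENNReal.ofReal (4 * Real.pi * a * ρμ ^ 2 * ℓ ^ 3 +
        (C₁ + C₂ + 4 * Real.pi) * n * a / ℓ ^ 3 * (1 + a ^ 2 * (n + 1) ^ 2 / ℓ ^ 2 + (n + 1) * R ^ 2 / ℓ ^ 2) +
        (C₁ + C₂ + 4 * Real.pi) * a * ρμ) ≠ 0 := by
      rw [Ne, ENNReal.ofReal_eq_zero, not_le]; exact hcoef
    calc _ ≤ (⊤ : ℝ≥0∞) := le_top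
      _ = ENNReal.ofReal (4 * Real.pi * a * ρμ ^ 2 * ℓ ^ 3 +
            (C₁ + C₂ + 4 * Real.pi) * n * a / ℓ ^ 3 * (1 + a ^ 2 * (n + 1) ^ 2 / ℓ ^ 2 + (n + 1) * R ^ 2 / ℓ ^ 2) +
            (C₁ + C₂ + 4 * Real.pi) * a * ρμ) * nrm := by rw [hnt, ENNReal.mul_top h0]
      _ ≤ _ := le_add_self
  -- finite forms
  have hNt : Np ≠ ⊤ := by
    have h1 : ENNReal.ofReal (b / ℓ ^ 2) * Np ≤ kin := nPlusBoxN_le_kinBoxN χ ℓ s b u Φ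
    have h2 : ENNReal.ofReal (b / ℓ ^ 2) ≠ 0 := by
      rw [Ne, ENNReal.ofReal_eq_zero, not_le]; positivity
    intro htop
    rw [htop, ENNReal.mul_top h2, top_le_iff] at h1
    exact hkt h1
  have hAt : attr ≠ ⊤ := by
    refine ne_top_of_le_ne_top ?_ (lintegral_attrBoxN_le hω hsL hR hℓ hCχ hDhalf hRD ρμ u Φ)
    refine ENNReal.mul_ne_top (ENNReal.mul_ne_top ENNReal.ofReal_ne_top ?_) hnt
    exact ENNReal.mul_ne_top (by finiteness) (ENNReal.mul_ne_top (ENNReal.mul_ne_top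
      (ENNReal.mul_ne_top (by finiteness) (by finiteness)) (by finiteness))
      (ENNReal.mul_ne_top ENNReal.ofReal_ne_top hsL))
  -- (2.25) and (2.26)
  have h25 := H25 ℓ ρμ hℓ hρμ hRℓ1 n u Φ hΦm hΦs hnt hrt hAt hNt
  have h26 := H26 b ℓ hb hℓ hRℓ2 n u Φ hΦm hΦs hnt hrt hkt
  -- pass to real numbers
  have hIgt : gOmegaIntegral v ω ≠ ⊤ :=
    ne_top_of_le_ne_top (ENNReal.mul_ne_top ENNReal.ofReal_ne_top hsL) (gOmegaIntegral_le hω)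
  have hIg : (gOmegaIntegral v ω).toReal ≤ 8 * Real.pi * a := by
    have h := ENNReal.toReal_mono (ENNReal.mul_ne_top ENNReal.ofReal_ne_top hsL) (gOmegaIntegral_le hω)
    rwa [ENNReal.toReal_mul, ENNReal.toReal_ofReal (by positivity)] at h
  have key := eq243_real ENNReal.toReal_nonneg ENNReal.toReal_nonneg ha0.le hρμ.le hℓ hC₁.le hC₂.le
    hIg h25 h26
  -- and back
  have hSq : 0 ≤ 2 * Real.pi * (a / ℓ ^ 3) * (ρμ * ℓ ^ 3 - n) ^ 2 := by positivity
  have hg : 0 ≤ b / ℓ ^ 2 := by positivity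
  have hCg : 0 ≤ (C₁ + C₂ + 4 * Real.pi) * a * ((n + 1) / ℓ ^ 3 + ρμ) := by positivity
  rw [← ENNReal.toReal_le_toReal (by finiteness) (by finiteness)]
  rw [ENNReal.toReal_add (by finiteness) (by finiteness), ENNReal.toReal_add hAt (by finiteness),
    ENNReal.toReal_add (by finiteness) (by finiteness), ENNReal.toReal_add (by finiteness) (by finiteness),
    ENNReal.toReal_add hkt hrt]
  simp only [ENNReal.toReal_mul, ENNReal.toReal_ofReal hSq, ENNReal.toReal_ofReal hg,
    ENNReal.toReal_ofReal hCg, ENNReal.toReal_ofReal hcoef.le]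
  exact key

end Assembly

end Literature.MathematicalPhysics.QuantumManyBody.BoseGas

end
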